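import Summits.ResolutionOfSingularities.ResolutionOfSingularities.Theorems.FrobeniusClosingPatchingRelPerfectConeTiltFamilyLevelTwo
import Summits.ResolutionOfSingularities.ResolutionOfSingularities.Theorems.FrobeniusClosingPatchingRelPerfectConeDepthTwo
import Summits.ResolutionOfSingularities.ResolutionOfSingularities.Theorems.FrobeniusClosingPatchingRelPerfectCoreRungConeMember
import Literature.AlgebraicGeometry.Resolution.BlowupPointSubalgebra
import HarnessLib

/-!
# Crux `PatchingRelPerfect` (stmt-ResolutionOfSingularities-16161), chain w52 — the permissible
# tilt FAMILY of the cone at depth two: `(x₀x₁ + x₂² + x₃μ) + 𝔪⁴ ∈ 𝒞` for EVERY `μ ∈ (x₀,x₁,x₂)·𝔪`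

[OURS · L1 W5.2 · rung] Kernel sentence (iii) at the quadric cone, tame half, as ONE kernel
theorem: `S` regular local with regular system of parameters `x₀, …, x₃` (every characteristic,
every residue field), `q = x₀x₁ + x₂²`, `P = (x₀, x₁, x₂)`; for every `μ ∈ P·𝔪` the depth-two
member `I = (q + x₃μ) + 𝔪⁴` (NOT `u`-graded unless `x₃μ ∈ (q) + 𝔪⁴`) is in the companion class,
with the r2c companion `(P + 𝔪²)(I + 𝔪²(P + 𝔪²)) · 𝔪 ⊇ 𝔪⁷` and the r2c tower (vertex `z₀` —
weight-two-permissible BECAUSE `μ ∈ P·𝔪` —, then `C̃`, `C̃'`).  `μ = 0` is r2c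
(`…ConeDepthTwo.lean`), `μ = x₂x₃` is r2c♯ (`…ConeTilt.lean`).  The complementary NON-permissible
tilts (`x₃³`-type: `ord_{z₀} K = 1`, maximal contact migrates to the strict transform of `V(f)`)
are this seat's HAND-NOTE-nongraded-A2.md (FOUND by hand; no certificate here).  PROVED:

* `F_add_mul_notMem_span_u`, `coneAddMul_charts` (all four Rees charts of `Bl_𝔪`);
* `companion_cone_add_mul_sup_pow_four` (explicit companion `Q · 𝔪 ⊇ 𝔪⁷`, every blow-up along
  `I · Q · 𝔪` regular), `coreRung_cone_add_mul_sup_pow_four`,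
  `coreRung_fourthPowersPlus_cone_add_mul`, `coreRung_fourthPowersPlus_cone_add_mul_of_ringKrullDim`,
  `atomDimFourBlowupAt_fourthPowersPlus_cone_add_mul`.

BC5-type FORMAT evidence; nothing here is a statement of the manuscript under review.

## References

* The Stacks Project, Tags 080A, 080B, 0804, 07Z3, 0BIQ. [StacksProject]
* Q. Liu, *Algebraic Geometry and Arithmetic Curves*, OUP 2002, Thm. 8.1.19 (a). [Liu2002]
* H. Matsumura, *Commutative Ring Theory*, CUP 1986, Thms. 14.2, 16.2, 16.3. [Matsumura1987]
-/

-- `Summit.<Summit>.<Sub>.Theorems` with `Sub = Summit` (single-conjunct summit, D-0017)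
set_option linter.dupNamespace false

noncomputable section

open CategoryTheory CategoryTheory.Limits AlgebraicGeometry Literature.AlgebraicGeometry.Resolution
open IsLocalRing

namespace Summit.ResolutionOfSingularities.ResolutionOfSingularities.Theorems

namespace ConeRung

universe u


/-! ## Level one over a regular local base -/

section LevelOneRegular

variable {S : Type u} [CommRing S] [IsRegularLocalRing S] (x : Fin 4 → S)
  (hx : Ideal.span (Set.range x) = IsLocalRing.maximalIdeal S)
  (hd : (IsLocalRing.maximalIdeal S).spanFinrank = 4) (μ : S)
  (hμ : μ ∈ Ideal.span {x 0, x 1, x 2} * Ideal.span (Set.range x))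

local notation3 "M" => Ideal.span (Set.range x)
local notation3 "I2t" => Ideal.span {x 0 * x 1 + x 2 ^ 2 + x 3 * μ} ⊔ Ideal.span (Set.range x) ^ 4
local notation3 "PP" => Ideal.span {x 0, x 1, x 2}
local notation3 "QQ2t" => (PP ⊔ M ^ 2) * (I2t ⊔ M ^ 2 * (PP ⊔ M ^ 2))
/-- the vertex-chart family index `k ↦ castSucc k ≠ 3` -/
local notation3 "jJ3" =>
  (fun k : Fin 3 => (⟨Fin.castSucc k, castSucc_ne_three k⟩ : {j : Fin 4 // j ≠ 3}))

/-! ### `F + u m ∉ (u)` on every chart -/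

include hx hd in
/-- **`F + u m ∉ (u)`** on every Rees chart (`F ∉ (u)`, `F_notMem_span_u`).
[cite: StacksProject, Tag 0BIQ] -/
theorem F_add_mul_notMem_span_u (i : Fin 4) (m : chartRing x i) :
    chartGen x i 0 * chartGen x i 1 + chartGen x i 2 ^ 2 + chartBase x i (x i) * m ∉
      Ideal.span {chartBase x i (x i)} :=
  fun h => F_notMem_span_u x hx hd i (by
    have e : chartGen x i 0 * chartGen x i 1 + chartGen x i 2 ^ 2 =
        (chartGen x i 0 * chartGen x i 1 + chartGen x i 2 ^ 2 + chartBase x i (x i) * m) -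
        chartBase x i (x i) * m := by ring
    rw [e]
    exact Ideal.sub_mem _ h (Ideal.mul_mem_right _ _ (Ideal.subset_span rfl)))

/-! ### The four charts of `Bl_𝔪`: `x₀, x₁, x₂` by the two-step tower for `(u, F + u m)`, the
vertex chart `x₃` by the abstract level two -/

include hx hd hμ in
/-- **Every blow-up of every Rees chart `Spec B_i` along `(I Q) B_i` is regular** — charts
`i = 0, 1, 2`: `(u, F + u m)` is a weakly regular pair with regular quotient, two-step Euclid tower;
vertex chart `i = 3`: the abstract level two (`isRegular_of_isBlowup_LKm_mul_span`) with `A = B₃`,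
`t = u`, `v_k = e_k` and the tilt `m ∈ (e₀, e₁, e₂)` of `exists_tilt`.
[cite: Liu2002, Thm. 8.1.19 (a)] [cite: StacksProject, Tag 080A] -/
theorem coneAddMul_charts (i : Fin 4) (Y : Scheme.{u}) (ρ : Y ⟶ Spec (.of (chartRing x i)))
    (hρ : IsBlowup ρ (affineBlowup.idealSheaf ((I2t * QQ2t).map (chartBase x i)))) :
    Scheme.IsRegular Y := by
  by_cases hi : i = 3
  · subst hi
    haveI : IsDomain S := isDomain_of_isRegularLocalRing S
    have hqr := isQuasiRegular_regularSystemOfParameters hd x hx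
    haveI : IsRegularRing (chartRing x 3) := isRegularRing_chart x hx hd 3
    haveI := isRegularRing_residue x hx
    haveI := isDomain_residue x hx
    have hx3 : x 3 ≠ 0 := (isRsopPart_comp_of_rsop hd x hx id Function.injective_id).ne_zero 3
    haveI : IsDomain (chartRing x 3) := isDomain_chartRing x 3 hx3
    haveI : IsRegularRing (chartRing x 3 ⧸ Ideal.span (Set.range
        (Fin.cons (chartBase x 3 (x 3)) (fun k : Fin 3 => chartGen x 3 (jJ3 k).1) :
          Fin 4 → chartRing x 3))) :=
      isRegularRing_quot_cons_chartGen x 3 jJ3 hqr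
    haveI : IsDomain (chartRing x 3 ⧸ Ideal.span (Set.range
        (Fin.cons (chartBase x 3 (x 3)) (fun k : Fin 3 => chartGen x 3 (jJ3 k).1) :
          Fin 4 → chartRing x 3))) :=
      isDomain_quot_span_range_cc x hx hd
    haveI : IsDomain (chartRing x 3 ⧸ Ideal.span {chartBase x 3 (x 3)}) :=
      isDomain_chartRing_quot_span x 3 hqr
    have hc : IsQuasiRegular (Fin.cons (chartBase x 3 (x 3))
        (fun k : Fin 3 => chartGen x 3 (jJ3 k).1) : Fin 4 → chartRing x 3) :=
      isQuasiRegular_cons_chartGen x 3 jJ3 hqr jJ3_injective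
    have hv : ∀ k : Fin 3, chartGen x 3 (jJ3 k).1 ∉ Ideal.span {chartBase x 3 (x 3)} :=
      fun k => chartGen_notMem_span_u x hx hd 3 _ (castSucc_ne_three k)
    have hFt := F_notMem_span_u x hx hd 3
    have hreg1 : ∀ (k : Fin 3) (P : Ideal (chartRing x 3 ⧸ Ideal.span {chartBase x 3 (x 3),
        chartGen x 3 0 * chartGen x 3 1 + chartGen x 3 2 ^ 2})) [P.IsPrime],
        Ideal.Quotient.mk _ (chartGen x 3 (Fin.castSucc k)) ∉ P →
          IsRegularLocalRing (Localization.AtPrime P) :=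
      fun k P _ hP => isRegularLocalRing_quot_span_u_F_three x hx hd P k hP
    obtain ⟨m, hmP, hm⟩ := exists_tilt x μ 3 hμ
    rw [map_chartBase_I2Qm x μ 3 m hm] at hρ
    have hu5 : chartBase x 3 (x 3) ^ 5 ∈ nonZeroDivisors (chartRing x 3) :=
      pow_mem (reesChartBase_mem_nonZeroDivisors (x 3)
        (Ideal.mem_span_range_self (f := x) (x := 3))) 5
    exact isRegular_of_isBlowup_span_singleton_mul_of_forall hu5 _
      (fun Y' ρ' h' => isRegular_of_isBlowup_LKm_mul_span (chartBase x 3 (x 3))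
        (fun k : Fin 3 => chartGen x 3 (jJ3 k).1) m hc hv hFt hmP hreg1 h') hρ
  · haveI := isRegularRing_chart x hx hd i
    haveI := isDomain_residue x hx
    have hqr := isQuasiRegular_regularSystemOfParameters hd x hx
    haveI := isDomain_chartRing_quot_span x i hqr
    obtain ⟨m, -, hm⟩ := exists_tilt x μ i hμ
    set x' : Fin 2 → chartRing x i := Fin.cons (chartBase x i (x i))
      (fun _ : Fin 1 => chartGen x i 0 * chartGen x i 1 + chartGen x i 2 ^ 2 +
        chartBase x i (x i) * m) with hx'def
    have hx' : IsQuasiRegular x' :=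
      isQuasiRegular_of_isWeaklyRegular _ (CoreRungTower.isWeaklyRegular_pair_of_notMem
        (reesChartBase_mem_nonZeroDivisors (x i) (Ideal.mem_span_range_self (f := x) (x := i)))
        (F_add_mul_notMem_span_u x hx hd i m))
    have hR' : IsRegularRing (chartRing x i ⧸ Ideal.span (Set.range x')) := by
      have h : Ideal.span (Set.range x') = Ideal.span {chartBase x i (x i),
          chartGen x i 0 * chartGen x i 1 + chartGen x i 2 ^ 2} := by
        rw [hx'def, Fin.range_cons (chartBase x i (x i))
          (fun _ : Fin 1 => chartGen x i 0 * chartGen x i 1 + chartGen x i 2 ^ 2 +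
            chartBase x i (x i) * m), Set.range_const]
        exact span_u_F_add_mul x i m
      rw [h]
      fin_cases i
      · exact isRegularRing_quot_span_u_F_zero x hx hd
      · exact isRegularRing_quot_span_u_F_one x hx hd
      · exact isRegularRing_quot_span_u_F_two x hx hd
      · exact absurd rfl hi
    have hu5 : chartBase x i (x i) ^ 5 ∈ nonZeroDivisors (chartRing x i) :=
      pow_mem (reesChartBase_mem_nonZeroDivisors (x i)
        (Ideal.mem_span_range_self (f := x) (x := i))) 5
    rw [map_chartBase_I2Qm_of_ne_three x μ i m hi hm, ← CoreRungTower.towerTwo_eq] at hρ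
    exact CoreRungTower.isRegular_of_isBlowup_span_singleton_mul hu5 _
      (fun Y' ρ' h' => isRegular_of_isBlowup_tower 2 x' (fun _ : Fin 1 => (1 : Fin 2))
        (Function.injective_of_subsingleton _) hx' hR' h') hρ

include hx hd hμ in
/-- **`I = (x₀x₁ + x₂² + x₃μ) + 𝔪⁴`, `μ ∈ P·𝔪`, is in the companion class `𝒞`** with companion `Q · 𝔪 ⊇ 𝔪⁷`.
[cite: StacksProject, Tag 080A] -/
theorem companion_cone_add_mul_sup_pow_four :
    IsLocalRing.maximalIdeal S ^ 7 ≤ QQ2t * M ∧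
      ∀ (Y : Scheme.{u}) (b : Y ⟶ Spec (.of S)),
        IsBlowup b (affineBlowup.idealSheaf (I2t * (QQ2t * M))) → Scheme.IsRegular Y := by
  refine ⟨?_, fun Y b hb => ?_⟩
  · rw [← hx, show (7 : ℕ) = 2 + (2 + 2) + 1 from rfl, pow_add, pow_add, pow_add, pow_one]
    exact Ideal.mul_mono (Ideal.mul_mono le_sup_right
      ((Ideal.mul_mono le_rfl le_sup_right).trans le_sup_right)) le_rfl
  · rw [← mul_assoc] at hb
    exact isRegular_of_isBlowup_mul_of_charts x (I2t * QQ2t) (coneAddMul_charts x hx hd μ hμ) hb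

include hx hd hμ in
/-- **CORE RUNG — the permissible tilt family.**  For `S` regular local with regular system of
parameters `x₀, …, x₃`, every `μ ∈ (x₀, x₁, x₂)·𝔪` and `I = (x₀x₁ + x₂² + x₃μ) + 𝔪⁴`, every blowing
up `T = Bl_I Spec S` carries a non-zero ideal sheaf cosupported in the closed fibre whose blowing up
is regular.  Every characteristic, every residue field. [cite: StacksProject, Tag 080A]
[cite: Liu2002, Thm. 8.1.19 (a)] -/
theorem coreRung_cone_add_mul_sup_pow_four (T : Scheme.{u}) (f : T ⟶ Spec (.of S))
    (hf : IsBlowup f (affineBlowup.idealSheaf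
      (Ideal.span {x 0 * x 1 + x 2 ^ 2 + x 3 * μ} ⊔ IsLocalRing.maximalIdeal S ^ 4))) :
    ∃ (J : T.IdealSheafData) (T' : Scheme.{u}) (π : T' ⟶ T), J ≠ ⊥ ∧
      (∀ t : T, t ∈ J.support → f.base t = IsLocalRing.closedPoint S) ∧
      IsBlowup π J ∧ Scheme.IsRegular T' := by
  haveI : IsDomain S := isDomain_of_isRegularLocalRing S
  have hx0 : x 0 ≠ 0 := (isRsopPart_comp_of_rsop hd x hx id Function.injective_id).ne_zero 0
  have h𝔪 : IsLocalRing.maximalIdeal S ≠ ⊥ := fun h => hx0 (by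
    have := hx.le (Ideal.subset_span (Set.mem_range_self 0)); rw [h] at this
    exact (Submodule.mem_bot S).mp this)
  have hI : (I2t) ≠ ⊥ := fun h => pow_ne_zero 4 h𝔪 (by
    rw [← hx]; exact eq_bot_iff.mpr (le_sup_right.trans h.le))
  have hQ : IsLocalRing.maximalIdeal S ^ 6 ≤ QQ2t := by
    rw [← hx, show (6 : ℕ) = 2 + (2 + 2) from rfl, pow_add, pow_add]
    exact Ideal.mul_mono le_sup_right ((Ideal.mul_mono le_rfl le_sup_right).trans le_sup_right)
  rw [← hx] at hf
  exact atomConclusion_of_pointBlowup_charts x hx h𝔪 hI hQ (coneAddMul_charts x hx hd μ hμ) T f hf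

include hx hd hμ in
/-- **The Frobenius-shaped variant `(x₀⁴, x₁⁴, x₂⁴, x₃⁴, x₀x₁ + x₂² + x₃μ)`** — a sup-reduction of
`(f) + 𝔪⁴` (`(xᵢ⁴) · 𝔪¹² = 𝔪¹⁶`). [cite: StacksProject, Tag 080A] [cite: Liu2002, Thm. 8.1.19 (a)] -/
theorem coreRung_fourthPowersPlus_cone_add_mul (T : Scheme.{u}) (f : T ⟶ Spec (.of S))
    (hf : IsBlowup f (affineBlowup.idealSheaf
      (Ideal.span (Set.range (fun i : Fin 4 => x i ^ 4) ∪ {x 0 * x 1 + x 2 ^ 2 + x 3 * μ})))) :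
    ∃ (J : T.IdealSheafData) (T' : Scheme.{u}) (π : T' ⟶ T), J ≠ ⊥ ∧
      (∀ t : T, t ∈ J.support → f.base t = IsLocalRing.closedPoint S) ∧
      IsBlowup π J ∧ Scheme.IsRegular T' := by
  haveI : IsDomain S := isDomain_of_isRegularLocalRing S
  have hx0 : x 0 ≠ 0 := (isRsopPart_comp_of_rsop hd x hx id Function.injective_id).ne_zero 0
  -- the pigeonhole `(xᵢ⁴) · 𝔪¹² = 𝔪¹⁶`
  have hred :
      Ideal.span (Set.range fun i : Fin 4 => x i ^ 4) * (M ^ 4) ^ 3 = (M ^ 4) ^ (3 + 1) := by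
    rw [← pow_mul, ← pow_mul, CoreRung.span_powers_mul_pow_eq_pow x rfl (by norm_num)]
  have hle : Ideal.span (Set.range fun i : Fin 4 => x i ^ 4) ≤ M ^ 4 := by
    rw [Ideal.span_le]
    rintro _ ⟨i, rfl⟩
    exact Ideal.pow_mem_pow (Ideal.subset_span (Set.mem_range_self i)) 4
  have hI :
      Ideal.span {x 0 * x 1 + x 2 ^ 2 + x 3 * μ} ⊔
        Ideal.span (Set.range fun i : Fin 4 => x i ^ 4) ≠ ⊥ :=
    fun h => pow_ne_zero 4 hx0 ((Submodule.eq_bot_iff _).mp h _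
      (Ideal.mem_sup_right (Ideal.subset_span
        (Set.mem_range_self (f := fun i : Fin 4 => x i ^ 4) 0))))
  have hKm : IsLocalRing.maximalIdeal S ^ 4 ≤ I2t := by rw [← hx]; exact le_sup_right
  rw [Ideal.span_union, sup_comm] at hf
  have hC := companion_cone_add_mul_sup_pow_four x hx hd μ hμ
  obtain ⟨Y, b, hb⟩ := exists_isBlowup (Spec (.of S)) (affineBlowup.idealSheaf (I2t * (QQ2t * M)))
  exact coreRung_sup_reduction_of_companion hle hred hI hKm
    ⟨QQ2t * M, 7, hC.1, Y, b, hb, hC.2 Y b hb⟩ T f hf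

end LevelOneRegular

/-- **The `TargetR2pt` binder shape** (plan-1's `ChainW52TargetsC.lean`): dimension given as
`ringKrullDim S = 4` with a generating family `x` of length `4`.
[cite: StacksProject, Tag 080A] [cite: Liu2002, Thm. 8.1.19 (a)] -/
theorem coreRung_fourthPowersPlus_cone_add_mul_of_ringKrullDim {S : Type u} [CommRing S]
    [IsRegularLocalRing S] (x : Fin 4 → S)
    (hx : Ideal.span (Set.range x) = IsLocalRing.maximalIdeal S)
    (hdim : ringKrullDim S = (4 : ℕ)) (μ : S)
    (hμ : μ ∈ Ideal.span {x 0, x 1, x 2} * IsLocalRing.maximalIdeal S)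
    (T : Scheme.{u}) (f : T ⟶ Spec (.of S))
    (hf : IsBlowup f (affineBlowup.idealSheaf
      (Ideal.span (Set.range (fun i : Fin 4 => x i ^ 4) ∪ {x 0 * x 1 + x 2 ^ 2 + x 3 * μ})))) :
    ∃ (J : T.IdealSheafData) (T' : Scheme.{u}) (π : T' ⟶ T), J ≠ ⊥ ∧
      (∀ t : T, t ∈ J.support → f.base t = IsLocalRing.closedPoint S) ∧
      IsBlowup π J ∧ Scheme.IsRegular T' := by
  have hd : (IsLocalRing.maximalIdeal S).spanFinrank = 4 := by
    have h := IsRegularLocalRing.spanFinrank_maximalIdeal (R := S)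
    rw [hdim] at h
    exact_mod_cast h
  rw [← hx] at hμ
  exact coreRung_fourthPowersPlus_cone_add_mul x hx hd μ hμ T f hf

/-- **The same for `(f) + 𝔪⁴` in the `ringKrullDim` binder shape.** [cite: StacksProject, Tag 080A] -/
theorem coreRung_cone_add_mul_sup_pow_four_of_ringKrullDim {S : Type u} [CommRing S]
    [IsRegularLocalRing S] (x : Fin 4 → S)
    (hx : Ideal.span (Set.range x) = IsLocalRing.maximalIdeal S)
    (hdim : ringKrullDim S = (4 : ℕ)) (μ : S)
    (hμ : μ ∈ Ideal.span {x 0, x 1, x 2} * IsLocalRing.maximalIdeal S)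
    (T : Scheme.{u}) (f : T ⟶ Spec (.of S))
    (hf : IsBlowup f (affineBlowup.idealSheaf
      (Ideal.span {x 0 * x 1 + x 2 ^ 2 + x 3 * μ} ⊔ IsLocalRing.maximalIdeal S ^ 4))) :
    ∃ (J : T.IdealSheafData) (T' : Scheme.{u}) (π : T' ⟶ T), J ≠ ⊥ ∧
      (∀ t : T, t ∈ J.support → f.base t = IsLocalRing.closedPoint S) ∧
      IsBlowup π J ∧ Scheme.IsRegular T' := by
  have hd : (IsLocalRing.maximalIdeal S).spanFinrank = 4 := by
    have h := IsRegularLocalRing.spanFinrank_maximalIdeal (R := S)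
    rw [hdim] at h
    exact_mod_cast h
  rw [← hx] at hμ
  exact coreRung_cone_add_mul_sup_pow_four x hx hd μ hμ T f hf

/-- **The registered core's binder shape, restricted to the member** (hypotheses of
`stub_atomDimFourBlowup`; characteristic, completeness, residue field and the off-fibre hypothesis
unused). [cite: StacksProject, Tag 080A] [cite: Liu2002, Thm. 8.1.19 (a)] -/
theorem atomDimFourBlowupAt_fourthPowersPlus_cone_add_mul (p : ℕ) (_hp : p.Prime) (S : Type)
    [CommRing S] [IsRegularLocalRing S] [CharP S p] [IsAdicComplete (IsLocalRing.maximalIdeal S) S]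
    [PerfectField (IsLocalRing.ResidueField S)] (hS : ringKrullDim S = (4 : ℕ))
    (x : Fin 4 → S) (hx : Ideal.span (Set.range x) = IsLocalRing.maximalIdeal S) (μ : S)
    (hμ : μ ∈ Ideal.span {x 0, x 1, x 2} * IsLocalRing.maximalIdeal S)
    (T : Scheme.{0}) (f : T ⟶ Spec (.of S))
    (hf : IsBlowup f (affineBlowup.idealSheaf
      (Ideal.span (Set.range (fun j : Fin 4 => x j ^ 4) ∪ {x 0 * x 1 + x 2 ^ 2 + x 3 * μ}))))
    (_hoff : ∀ t : T, f.base t ≠ IsLocalRing.closedPoint S →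
      IsRegularLocalRing (T.presheaf.stalk t)) :
    ∃ (J : T.IdealSheafData) (T' : Scheme.{0}) (π : T' ⟶ T), J ≠ ⊥ ∧
      (∀ t : T, t ∈ J.support → f.base t = IsLocalRing.closedPoint S) ∧
      IsBlowup π J ∧ Scheme.IsRegular T' :=
  coreRung_fourthPowersPlus_cone_add_mul_of_ringKrullDim x hx hS μ hμ T f hf

end ConeRung

end Summit.ResolutionOfSingularities.ResolutionOfSingularities.Theorems

end
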